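import Summits.QuantumFields.YangMills.Theorems.BalabanUVNodesN15KingModelGraphReplacementSlices
import Summits.QuantumFields.YangMills.Theorems.BalabanUVNodesN15KingModelTwoSpacingCommonConstants
import Summits.QuantumFields.YangMills.Theorems.BalabanUVNodesN15KingModelFullPropagatorOperatorPrinted

/-!
# BalabanUVNodes ∕ N15 — THE KING-MODEL RUNG (PART Η-c): PROPOSITION 3.6's REPLACEMENT STEP **BY NAME AT `A = 0`** — for EVERY graph shape whose internal
# lines carry the slices `G^η_{(j)}`, `∂^η_μG^η_{(j)}` of King's own `A = 0` propagator (2.13)∕(2.17) on the rung's two-spacing tori,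
# `|E^{(K+n)}(H(j)) − E^{(K)}(H(j))| ≤ L^{−γK}·Σ_ℓ 𝔼^{(K)}(H(j); ℓ lowered by γ) + …` and `≤ (Σ_ℓ L^{−γ j_ℓ} + Σ_υ ϑ_υ)·𝔼^{(K)}(H(j))`, with ONE `(C, δ₀, γ)` per Hölder
# exponent, uniformly in the mass `0 < m² ≤ m₀²`, the volume `2L^m`, the number of scales `K ≥ 1`, `n ≥ 1` and the graph — from Ω₂'s common constants for
# Propositions 3.7∕3.9 (`king_props37_38_39_commonConstants`), the fibre count of King's pairing and the pairing defect
# (Track A, DAG node N15 = NE2; FAN-OUT v1.1 §N15 s3 «KING-MODEL RUNG … NE2's analogue DECIDED in the model»)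

HONEST FRAMING.  Count-neutral (cell `pub-ymgap`, seat `pub-ymgap-dag-n15-e` g25; `--supports stmt-QuantumFields-27366 --as helper` = K3⁸
`SpineGivenEndpointR13SepCoPHV`).  TEMPLATE LITERATURE: C. King, *The U(1) Higgs model. I. The continuum limit*, Commun. Math. Phys. **102** (1986) 649–677
[King1986], proof of Proposition 3.6 pp. 663–665 (the replacement step), with Propositions 3.7 (3.63) p. 663 and 3.9 (3.73) p. 665 FOR KING's `A = 0` SLICES
— in the tree BY NAME (part Ρ `prop37PrintedAt_king_zeroField`, part Χ `prop39PrintedAt_…`, merged by part Ω₂ `king_props37_38_39_commonConstants` on the ONE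
record `kingTwoSpacingFull L a m² j n` of part Ω₁).  This file puts them on part Η-b's `graph_replacement_twoSpacing(_reduced∕_ratio)`.  King's U(1)∕`A = 0`
MODEL; NOT Bałaban's non-abelian `G(U)` of [B9]; NOT a node discharge; nothing continuum ∕ ℝ⁴ ∕ OS ∕ mass-gap ∕ Clay.  0 `sorry`; standard axioms.

THE PRINT.  p. 665 [PDF 17], verbatim: *«Now we replace propagators on the internal lines, using the following proposition (also proved in Sect. 4):
Proposition 3.9. … First we fix the ordering I of the internal lines. If we replace a propagator G^{η′}_{(j)}(x′, y′) by G^η_{(j)}(x, y), the error is the same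
graph with a difference of propagators on one line. Redoing the analysis, we see that the degrees of some subgraphs have been reduced by γ; for γ small
enough, the exponents D(H_i) − γ are still positive, and the bound proceeds as before. This replacement is made for every internal line, and every ordering
I. Having done this, we can replace the sums of internal vertices x′ over T_{η′} by sums over x ∈ T_η, and this gives exactly E^{(k)}(H), proving Proposition
3.6.»*; p. 664: *«When x′ ∈ T_{η′}, we denote by x that point in T_η for which x′ ∈ B^n(x).»*; Prop. 3.7 p. 663: *«Furthermore, if we replace G^η_{(j)} by
G^{η′}_{(j)} throughout … the bounds are valid»*.

WHAT THIS FILE PROVES (namespace `Summit.QuantumFields.YangMills.BalabanUVNodes.N15KingModelRung.Curved`; `T = kingTwoSpacingFull L a m² j n`: coarse run `K = j.K`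
scales on `T_η = Tor (fine (L^K) (kingVol L j))`, fine run `K + n` on `T_{η′} = Tor (fine (L^{K+n}) (kingVol L j))`, King's pairing `kingSlicePt`).
* §1 ★ `card_filter_kingSlicePt` — every η-point has EXACTLY `(L^n)^{d+1}` η′-points over it (the rung's `sum_comp_underPtN`); `king_weight_repair`
  (`(L^n)^{d+1}·η′^{d+1} = η^{d+1}`).
* §2 ★★ `hiLine_kingTwoSpacingFull_le` — THE FINE SLICES' SIZES IN COARSE CURRENCY: Prop. 3.7 for the `(K+n)`-run at slice `j + n` (same length scale
  `L^{j+n}η′ = L^jη`), read through the pairing by part Χ-a's `mul_tdistT_kingSlicePt_le` (`L^n|x − y| ≤ |x′ − y′| + L^n − 1`), costs the factor `e^{δ₀}`: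
  `|G^{η′}_{(j)}(x′, y′)| ≤ C e^{δ₀}(L^jη)^{e} exp[−δ₀(L^jη)^{−1}|x − y|]` — part Η-b's hypothesis `hhi` DISCHARGED.
* §3 the spellings `kingLoLine`∕`kingHiLine` (line kernels), `kingSizeProfile`, `kingReducedProfile` on the torus site sorts (definitional wrappers of part
  Η-b's `loLine`∕`hiLine`∕`sizeProfile`∕`reducedProfile` on `T`) with their explicit readings (`kingLoLine_eq`, `kingSizeProfile_eq`, … — free of `a`, `m²`, `n`).
* §4 ★★★ **`king_graph_replacement_zeroField`**: for odd `L ≥ 3`, `a > 0`, `m₀² ≥ 0`, `0 < α < 1` THERE ARE `C, δ₀, γ > 0` such that for every mass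
  `0 < m² ≤ m₀²`, volume∕scales `j`, `n ≥ 1`, EVERY graph shape (`V`, internal lines `Λ` with `src`, `tgt`, slice indices `j_ℓ + 1 ≤ K`, kinds `κ_ℓ`, one-vertex
  factors `Υ` with sizes `p_υ` and rates `q_υ` through the pairing):
  `|E^{(K+n)}(H(j)) − E^{(K)}(H(j))| ≤ L^{−γK}·Σ_ℓ 𝔼^{(K)}_{C,δ₀}(H(j); ℓ at the exponent lowered by γ) + Σ_υ 𝔼^{(K)}_{C,δ₀}(H(j); υ ↦ q_υ)`, vertex weights
  `η^{d+1} = (L^K)^{−(d+1)}`, `η′^{d+1}`; ★★★ **`king_graph_replacement_zeroField_ratio`**: `≤ (Σ_ℓ L^{−γ j_ℓ} + Σ_υ ϑ_υ)·𝔼^{(K)}_{C,δ₀}(H(j))` for one-vertex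
  rates `q_υ = ϑ_υ p_υ`; ★ `king_graph_size_zeroField` (both graph values `≤ 𝔼^{(K)}_{C,δ₀}(H(j))`).

HONEST SCOPE.  (a) King's `A = 0` model (U(1) print, `h = g = 0` slices of [Ba4] (1.6) = King (2.13)), volumes `2L^m`, `K ≥ 1`, `n ≥ 1`, `0 < m² ≤ m₀²`, odd
`L ≥ 3` (the rung's standing family); constants per `α` (King's order).  (b) The replacement step ONLY: the power counting that sums `𝔼^{(K)}(H(j); ℓ lowered by
γ)` over the slice assignments `j` into (3.56)'s tree decay ((3.67)–(3.70), degrees, §3.5) is NOT claimed; one-vertex factors (external lines (3.71), sources,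
dressings (3.72)) enter as hypotheses here (part Η-d places the dressings by name).  (c) NOT Bałaban's `G(U)`; NE2 itself not touched; N15's booking unchanged.
Locators: [King1986] (2.13)–(2.17) p.653, Prop. 3.6 (3.56) p.662, (3.59) p.663, Prop. 3.7 (3.63) p.663, p.664 (pairing), Prop. 3.9 (3.73) p.665, pp.664–665.
-/

noncomputable section

namespace Summit.QuantumFields.YangMills.BalabanUVNodes.N15KingModelRung.Curved

open scoped BigOperators
open Finset
open Literature.MathematicalPhysics.QuantumFieldTheory.Balaban1983to89.B5Prop11Plancherel (Tor fine)
open Literature.MathematicalPhysics.QuantumFieldTheory.King1986.Torus (tdistT tdistT_nonneg torCongr)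
open Literature.MathematicalPhysics.QuantumFieldTheory.King1986.SlicePropagator (SliceKernels TwoSpacing Prop37PrintedAt Prop39PrintedAt)
open Summit.QuantumFields.YangMills.BalabanUVNodes.N15KingModelRung (KingVolIndex kingVol kingVol_neZero)
open Summit.QuantumFields.YangMills.BalabanUVNodes.N15KingModelRung.Graph

variable {d : ℕ} (L : ℕ) [NeZero L]

/-! ## §1 The fibres of King's pairing and the vertex weights -/

section Fibres

/-- ★ **EVERY η-POINT HAS EXACTLY `(L^n)^{d+1}` η′-POINTS OVER IT** (the block `B^n(x)`): the fibre count of King's pairing `x′ ↦ x` — part Η-a's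
uniform-fibre hypothesis for the rung's tori. [cite: King1986, p.664 («we denote by x that point in T_η for which x′ ∈ B^n(x)»), (2.10) p.653] -/
theorem card_filter_kingSlicePt (K n : ℕ) (M : Fin (d + 1) → ℕ) [∀ μ, NeZero (M μ)] (x : Tor (fine (L ^ K) M)) :
    (univ.filter fun x' : Tor (fine (L ^ (K + n)) M) => kingSlicePt L K n M x' = x).card = (L ^ n) ^ (d + 1) := by
  classical
  have h1 : (((univ.filter fun x' : Tor (fine (L ^ (K + n)) M) => kingSlicePt L K n M x' = x).card : ℕ) : ℝ)
      = ∑ x' : Tor (fine (L ^ (K + n)) M), (if kingSlicePt L K n M x' = x then (1 : ℝ) else 0) := by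
    rw [Finset.sum_boole, Nat.cast_inj]
  have h2 : ∑ x' : Tor (fine (L ^ (K + n)) M), (if kingSlicePt L K n M x' = x then (1 : ℝ) else 0)
      = ∑ y' : Tor (fine (L ^ n * L ^ K) M), (if underPtN L K n M y' = x then (1 : ℝ) else 0) :=
    (torCongr (carrier_pow_add L K n M)).sum_comp (fun y' => if underPtN L K n M y' = x then (1 : ℝ) else 0)
  have h3 := sum_comp_underPtN L K n M (fun y => if y = x then (1 : ℝ) else 0)
  rw [Finset.sum_ite_eq' univ x, if_pos (mem_univ x), mul_one] at h3
  have h : (((univ.filter fun x' : Tor (fine (L ^ (K + n)) M) => kingSlicePt L K n M x' = x).card : ℕ) : ℝ) = (((L ^ n) ^ (d + 1) : ℕ) : ℝ) := by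
    rw [h1, h2, h3]; push_cast; ring
  exact_mod_cast h

omit [NeZero L] in
/-- **the vertex weights re-pair**: `(L^n)^{d+1}·η′^{d+1} = η^{d+1}` (`η = L^{−K}`, `η′ = L^{−(K+n)}`). [cite: King1986, p.665 («replace the sums of internal
vertices x′ over T_{η′} by sums over x ∈ T_η»)] -/
theorem king_weight_repair (hL0 : (0 : ℝ) < L) (K n : ℕ) :
    (((L ^ n) ^ (d + 1) : ℕ) : ℝ) * (((L : ℝ) ^ (K + n))⁻¹) ^ (d + 1) = (((L : ℝ) ^ K)⁻¹) ^ (d + 1) := by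
  push_cast
  rw [← mul_pow]
  congr 1
  rw [pow_add, mul_inv, ← mul_assoc, mul_comm ((L : ℝ) ^ n), mul_assoc, mul_inv_cancel₀ (pow_ne_zero _ hL0.ne'), mul_one]

end Fibres

/-! ## §2 The fine slices' sizes in coarse currency (Prop. 3.7 «Furthermore …» through the pairing) -/

section HiSizes

/-- ★★ **`|G^{η′}_{(j)}(x′, y′)| ≤ C e^{δ₀}(L^jη)^{e} exp[−δ₀(L^jη)^{−1}|x − y|]`**: Proposition 3.7 for the `(K+n)`-run's slice `j + n` — the SAME length scale
`L^{j+n}η′ = L^jη` — read through King's pairing (`L^n|x − y|_{T_η} ≤ |x′ − y′|_{T_{η′}} + L^n − 1`, part Χ-a), which costs at most `e^{δ₀(L^jη)^{−1}η} ≤ e^{δ₀}`: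
part Η-b's hypothesis `hhi` for the record `kingTwoSpacingFull L a m² j n`. [cite: King1986, Prop. 3.7 (3.63) p.663 («Furthermore, if we replace G^η_{(j)} by
G^{η′}_{(j)} throughout … the bounds are valid»), p.664 (pairing)] -/
theorem hiLine_kingTwoSpacingFull_le (hL : 2 ≤ L) (a msq : ℝ) (j : KingVolIndex d) (n : ℕ) {α C δ₀ : ℝ} (hC : 0 ≤ C) (hδ₀ : 0 ≤ δ₀)
    (h37' : haveI := kingVol_neZero L j
      Prop37PrintedAt α (kingSliceKernels L (j.K + n) j.m (kingVol L j) (fun _ => rfl) (one_le_add_of_one_le j.one_le_K n) a msq) C δ₀)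
    {jl : ℕ} (hjl : jl + 1 ≤ j.K) (κ : Option (Fin (d + 1)))
    (x' y' : haveI := kingVol_neZero L j; Tor (fine (L ^ (j.K + n)) (kingVol L j))) :
    haveI := kingVol_neZero L j
    ‖hiLine (kingTwoSpacingFull L a msq j n) jl κ x' y'‖
      ≤ sizeProfile (kingTwoSpacingFull L a msq j n) (C * Real.exp δ₀) δ₀ jl κ
          ((kingTwoSpacingFull L a msq j n).pt x') ((kingTwoSpacingFull L a msq j n).pt y') := by
  haveI := kingVol_neZero L j
  set T := kingTwoSpacingFull L a msq j n with hT
  set D' := kingSliceKernels L (j.K + n) j.m (kingVol L j) (fun _ => rfl) (one_le_add_of_one_le j.one_le_K n) a msq with hD'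
  have hL0 : (0 : ℝ) < L := by exact_mod_cast (show 0 < L by omega)
  have hjl' : jl + n + 1 ≤ D'.k := by show jl + n + 1 ≤ j.K + n; omega
  obtain ⟨h1, -, -⟩ := h37' (jl + n) hjl'
  have hB : |hiLine T jl κ x' y'| ≤ C * D'.slice (jl + n) ^ lineExp (d + 1) κ * Real.exp (-(δ₀ * (D'.slice (jl + n))⁻¹ * D'.dist x' y')) := by
    rcases κ with _ | μ
    · exact (h1 x' y').1
    · exact (h1 x' y').2 μ
  -- the slice lengths agree: `L^{j+n}η′ = L^jη`
  have hsT : T.lo.slice jl = (L : ℝ) ^ jl / (L : ℝ) ^ j.K := kingSliceKernels_slice (kingVol L j) (fun _ => rfl) j.one_le_K a msq jl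
  have hsD : D'.slice (jl + n) = T.lo.slice jl := by
    rw [hsT, hD', kingSliceKernels_slice, pow_add, pow_add]
    field_simp
  have hs0 : 0 < T.lo.slice jl := by rw [hsT]; positivity
  -- the pairing defect on the distances
  have hdist : T.lo.dist (T.pt x') (T.pt y') - ((L : ℝ) ^ j.K)⁻¹ ≤ D'.dist x' y' := by
    show tdistT (fine (L ^ j.K) (kingVol L j)) (kingSlicePt L j.K n (kingVol L j) x') (kingSlicePt L j.K n (kingVol L j) y') / (L : ℝ) ^ j.K
        - ((L : ℝ) ^ j.K)⁻¹ ≤ tdistT (fine (L ^ (j.K + n)) (kingVol L j)) x' y' / (L : ℝ) ^ (j.K + n)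
    have h := mul_tdistT_kingSlicePt_le L j.K n (kingVol L j) x' y'
    push_cast at h
    have hKp : (0 : ℝ) < (L : ℝ) ^ j.K := pow_pos hL0 _
    have hnp : (0 : ℝ) < (L : ℝ) ^ n := pow_pos hL0 _
    calc tdistT (fine (L ^ j.K) (kingVol L j)) (kingSlicePt L j.K n (kingVol L j) x') (kingSlicePt L j.K n (kingVol L j) y') / (L : ℝ) ^ j.K
          - ((L : ℝ) ^ j.K)⁻¹
        = ((L : ℝ) ^ n * tdistT (fine (L ^ j.K) (kingVol L j)) (kingSlicePt L j.K n (kingVol L j) x') (kingSlicePt L j.K n (kingVol L j) y')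
            - (L : ℝ) ^ n) / ((L : ℝ) ^ j.K * (L : ℝ) ^ n) := by
          field_simp
      _ ≤ tdistT (fine (L ^ (j.K + n)) (kingVol L j)) x' y' / ((L : ℝ) ^ j.K * (L : ℝ) ^ n) :=
          div_le_div_of_nonneg_right (by linarith) (by positivity)
      _ = tdistT (fine (L ^ (j.K + n)) (kingVol L j)) x' y' / (L : ℝ) ^ (j.K + n) := by rw [← pow_add]
  -- the exponential defect `e^{δ₀(L^jη)^{−1}η} ≤ e^{δ₀}`
  have hexp : Real.exp (-(δ₀ * (T.lo.slice jl)⁻¹ * D'.dist x' y'))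
      ≤ Real.exp δ₀ * Real.exp (-(δ₀ * (T.lo.slice jl)⁻¹ * T.lo.dist (T.pt x') (T.pt y'))) := by
    rw [← Real.exp_add]
    refine Real.exp_le_exp.2 ?_
    have hsi : 0 ≤ δ₀ * (T.lo.slice jl)⁻¹ := mul_nonneg hδ₀ (inv_nonneg.2 hs0.le)
    have hkey : δ₀ * (T.lo.slice jl)⁻¹ * ((L : ℝ) ^ j.K)⁻¹ ≤ δ₀ := by
      rw [hsT, inv_div, mul_assoc, div_mul_eq_mul_div, mul_inv_cancel₀ (pow_ne_zero _ hL0.ne'), one_div]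
      exact mul_le_of_le_one_right hδ₀ (inv_le_one_of_one_le₀ (one_le_pow₀ (by exact_mod_cast (show 1 ≤ L by omega))))
    nlinarith [mul_le_mul_of_nonneg_left hdist hsi]
  have hpow0 : 0 ≤ T.lo.slice jl ^ lineExp (d + 1) κ := Real.rpow_nonneg hs0.le _
  calc ‖hiLine T jl κ x' y'‖ = |hiLine T jl κ x' y'| := Real.norm_eq_abs _
    _ ≤ C * D'.slice (jl + n) ^ lineExp (d + 1) κ * Real.exp (-(δ₀ * (D'.slice (jl + n))⁻¹ * D'.dist x' y')) := hB
    _ ≤ C * T.lo.slice jl ^ lineExp (d + 1) κ * (Real.exp δ₀ * Real.exp (-(δ₀ * (T.lo.slice jl)⁻¹ * T.lo.dist (T.pt x') (T.pt y')))) := by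
        rw [hsD]; exact mul_le_mul_of_nonneg_left hexp (mul_nonneg hC hpow0)
    _ = sizeProfile T (C * Real.exp δ₀) δ₀ jl κ (T.pt x') (T.pt y') := by unfold sizeProfile; ring

end HiSizes

/-! ## §3 Concrete spellings of the line kernels and profiles on the rung's tori (definitional wrappers with the torus site sorts) -/

section Spellings

variable (a msq : ℝ) (j : KingVolIndex d) (n : ℕ)

/-- **THE COARSE LINE KERNELS OF `E^{(K)}(H(j))` AT `A = 0`** on `T_η = Tor (fine (L^K) (kingVol L j))`: part Η-b's `loLine` on the record — the slice `G^η_{(j_ℓ)}`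
of King's `A = 0` propagator `G_K` (part Ρ-e `kingSliceKernels`) or its gradient; independent of `n` (`kingLoLine_eq`). [cite: King1986, (2.13)–(2.17) p.653, (3.59) p.663] -/
def kingLoLine (jl : ℕ) (κ : Option (Fin (d + 1))) : Tor (fine (L ^ j.K) (kingVol L j)) → Tor (fine (L ^ j.K) (kingVol L j)) → ℝ :=
  haveI := kingVol_neZero L j
  loLine (kingTwoSpacingFull L a msq j n) jl κ

/-- **THE FINE LINE KERNELS OF `E^{(K+n)}(H(j))`** on `T_{η′} = Tor (fine (L^{K+n}) (kingVol L j))`: part Η-b's `hiLine` on the record (the `(K+n)`-run's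
slice `j_ℓ + n`). [cite: King1986, (3.60) p.663] -/
def kingHiLine (jl : ℕ) (κ : Option (Fin (d + 1))) : Tor (fine (L ^ (j.K + n)) (kingVol L j)) → Tor (fine (L ^ (j.K + n)) (kingVol L j)) → ℝ :=
  haveI := kingVol_neZero L j
  hiLine (kingTwoSpacingFull L a msq j n) jl κ

/-- **THE (3.63)-PROFILE ON `T_η`**: `C·(L^jη)^{e}·exp[−δ₀(L^jη)^{−1}|x − y|∕L^K]` (part Η-b's `sizeProfile` on the record; independent of `a`, `m²`, `n`:
`kingSizeProfile_eq`). [cite: King1986, (3.63) p.663] -/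
def kingSizeProfile (C δ₀ : ℝ) (jl : ℕ) (κ : Option (Fin (d + 1))) : Tor (fine (L ^ j.K) (kingVol L j)) → Tor (fine (L ^ j.K) (kingVol L j)) → ℝ :=
  haveI := kingVol_neZero L j
  sizeProfile (kingTwoSpacingFull L a msq j n) C δ₀ jl κ

/-- **THE PROFILE WITH THE EXPONENT LOWERED BY γ** on `T_η` (part Η-b's `reducedProfile` on the record). [cite: King1986, p.665, (3.73) p.665] -/
def kingReducedProfile (C δ₀ γ : ℝ) (jl : ℕ) (κ : Option (Fin (d + 1))) :
    Tor (fine (L ^ j.K) (kingVol L j)) → Tor (fine (L ^ j.K) (kingVol L j)) → ℝ :=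
  haveI := kingVol_neZero L j
  reducedProfile (kingTwoSpacingFull L a msq j n) C δ₀ γ jl κ

/-- reading: the coarse kernel is the `K`-run's slice datum (part Ρ-e), whatever `n`. [cite: King1986, (2.17) p.653] -/
theorem kingLoLine_eq (jl : ℕ) (κ : Option (Fin (d + 1))) (x y : Tor (fine (L ^ j.K) (kingVol L j))) :
    haveI := kingVol_neZero L j
    kingLoLine L a msq j n jl κ x y = (match κ with
      | none => (kingSliceKernels L j.K j.m (kingVol L j) (fun _ => rfl) j.one_le_K a msq).G jl x y
      | some μ => (kingSliceKernels L j.K j.m (kingVol L j) (fun _ => rfl) j.one_le_K a msq).dG jl μ x y) := by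
  cases κ <;> rfl

/-- reading: the (3.63)-profile in the torus' letters, `(L^jη) = L^j·ε_K`, `|x − y| = tdistT∕L^K` — free of `a`, `m²`, `n`. [cite: King1986, (3.63) p.663] -/
theorem kingSizeProfile_eq (C δ₀ : ℝ) (jl : ℕ) (κ : Option (Fin (d + 1))) (x y : Tor (fine (L ^ j.K) (kingVol L j))) :
    haveI := kingVol_neZero L j
    kingSizeProfile L a msq j n C δ₀ jl κ x y
      = C * ((L : ℝ) ^ jl * Literature.MathematicalPhysics.QuantumFieldTheory.King1986.ContinuumLimit.eps L j.K) ^ lineExp (d + 1) κ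
        * Real.exp (-(δ₀ * ((L : ℝ) ^ jl * Literature.MathematicalPhysics.QuantumFieldTheory.King1986.ContinuumLimit.eps L j.K)⁻¹
          * (tdistT (fine (L ^ j.K) (kingVol L j)) x y / (L : ℝ) ^ j.K))) := rfl

/-- reading: the lowered profile in the torus' letters — free of `a`, `m²`, `n`. [cite: King1986, (3.73) p.665] -/
theorem kingReducedProfile_eq (C δ₀ γ : ℝ) (jl : ℕ) (κ : Option (Fin (d + 1))) (x y : Tor (fine (L ^ j.K) (kingVol L j))) :
    haveI := kingVol_neZero L j
    kingReducedProfile L a msq j n C δ₀ γ jl κ x y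
      = C * ((L : ℝ) ^ jl * Literature.MathematicalPhysics.QuantumFieldTheory.King1986.ContinuumLimit.eps L j.K) ^ (lineExp (d + 1) κ - γ)
        * Real.exp (-(δ₀ * ((L : ℝ) ^ jl * Literature.MathematicalPhysics.QuantumFieldTheory.King1986.ContinuumLimit.eps L j.K)⁻¹
          * (tdistT (fine (L ^ j.K) (kingVol L j)) x y / (L : ℝ) ^ j.K))) := rfl

end Spellings

/-! ## §4 Proposition 3.6's replacement step BY NAME for King's `A = 0` slices -/

section ByName

/-- ★★★ **PROPOSITION 3.6's REPLACEMENT STEP BY NAME AT `A = 0` — ONE `(C, δ₀, γ)` PER HÖLDER EXPONENT, UNIFORMLY IN THE MASS, THE VOLUME, THE SCALES AND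
THE GRAPH.**  For odd `L ≥ 3`, `a > 0`, `m₀² ≥ 0`, `0 < α < 1` there are `C, δ₀, γ > 0` such that for every `0 < m² ≤ m₀²`, every `j` (volume `2L^{j.m}`,
`K = j.K ≥ 1` coarse scales), every `n ≥ 1` and EVERY graph shape — internal vertices `V` (weights `η^{d+1} = (L^K)^{−(d+1)}` on `T_η`, `η′^{d+1}` on `T_{η′}`),
internal lines `ℓ ∈ Λ` from `src ℓ` to `tgt ℓ` carrying the slice `j_ℓ` (`j_ℓ + 1 ≤ K`) of kind `κ_ℓ` of King's `A = 0` propagator, one-vertex factors `υ ∈ Υ`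
at `vtx υ` with sizes `p_υ` (both lattices, through the pairing) and rates `q_υ` —
`|E^{(K+n)}(H(j)) − E^{(K)}(H(j))| ≤ L^{−γK}·Σ_ℓ 𝔼^{(K)}_{C,δ₀}(H(j); ℓ at the exponent lowered by γ) + Σ_υ 𝔼^{(K)}_{C,δ₀}(H(j); υ ↦ q_υ)`.
ASSEMBLY: Ω₂ `king_props37_38_39_commonConstants` (Props. 3.7∕3.9 by name, one triple) + §2 (fine sizes in coarse currency, `C ↦ Ce^{δ₀}`) + §1 (fibres) +
part Η-b `graph_replacement_twoSpacing_reduced`. [cite: King1986, pp.664–665 (proof of Prop. 3.6), Prop. 3.7 (3.63) p.663, Prop. 3.9 (3.73) p.665] -/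
theorem king_graph_replacement_zeroField (hLodd : Odd L) (hL : 2 ≤ L) {a : ℝ} (ha : 0 < a) {m0sq : ℝ} (hm0 : 0 ≤ m0sq)
    {α : ℝ} (hα0 : 0 < α) (hα1 : α < 1) :
    ∃ C δ₀ γ : ℝ, 0 < C ∧ 0 < δ₀ ∧ 0 < γ ∧ ∀ (msq : ℝ), 0 < msq → msq ≤ m0sq → ∀ (j : KingVolIndex d) (n : ℕ), 1 ≤ n →
      ∀ (V Λ Υ : Type) [Fintype V] [DecidableEq V] [Fintype Λ] [DecidableEq Λ] [Fintype Υ] [DecidableEq Υ]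
        (src tgt : Λ → V) (js : Λ → ℕ), (∀ ℓ, js ℓ + 1 ≤ j.K) → ∀ (κ : Λ → Option (Fin (d + 1))) (vtx : Υ → V),
        haveI := kingVol_neZero L j
        ∀ (u : Υ → Tor (fine (L ^ j.K) (kingVol L j)) → ℝ) (u' : Υ → Tor (fine (L ^ (j.K + n)) (kingVol L j)) → ℝ)
          (p q : Υ → Tor (fine (L ^ j.K) (kingVol L j)) → ℝ),
          (∀ υ x, ‖u υ x‖ ≤ p υ x) → (∀ υ x', ‖u' υ x'‖ ≤ p υ (kingSlicePt L j.K n (kingVol L j) x')) →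
          (∀ υ x', ‖u' υ x' - u υ (kingSlicePt L j.K n (kingVol L j) x')‖ ≤ q υ (kingSlicePt L j.K n (kingVol L j) x')) →
          ‖graphValLS ((((L : ℝ) ^ (j.K + n))⁻¹) ^ (d + 1)) src tgt (fun ℓ => kingHiLine L a msq j n (js ℓ) (κ ℓ)) vtx u'
              - graphValLS ((((L : ℝ) ^ j.K)⁻¹) ^ (d + 1)) src tgt (fun ℓ => kingLoLine L a msq j n (js ℓ) (κ ℓ)) vtx u‖
            ≤ (L : ℝ) ^ (-(γ * j.K))
                * ∑ ℓ, graphValLS ((((L : ℝ) ^ j.K)⁻¹) ^ (d + 1)) src tgt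
                    (Function.update (fun ℓ => kingSizeProfile L a msq j n C δ₀ (js ℓ) (κ ℓ)) ℓ (kingReducedProfile L a msq j n C δ₀ γ (js ℓ) (κ ℓ))) vtx p
              + ∑ υ, graphValLS ((((L : ℝ) ^ j.K)⁻¹) ^ (d + 1)) src tgt (fun ℓ => kingSizeProfile L a msq j n C δ₀ (js ℓ) (κ ℓ)) vtx
                    (Function.update p υ (q υ)) := by
  obtain ⟨C, δ₀, γ, hC, hδ₀, hγ, H⟩ := king_props37_38_39_commonConstants (d := d) L hLodd hL ha hm0 hα0 hα1
  have hL1 : 1 ≤ L := by omega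
  have hL0 : (0 : ℝ) < L := by exact_mod_cast (show 0 < L by omega)
  refine ⟨C * Real.exp δ₀, δ₀, γ, by positivity, hδ₀, hγ, fun msq hm hcap j n hn V Λ Υ _ _ _ _ _ _ src tgt js hjs κ vtx u u' p q hp hp' hq => ?_⟩
  haveI := kingVol_neZero L j
  obtain ⟨h37, h37', -, h39⟩ := H msq hm hcap j n hn
  letI : Fintype (kingTwoSpacingFull L a msq j n).lo.S := inferInstanceAs (Fintype (Tor (fine (L ^ j.K) (kingVol L j))))
  letI : DecidableEq (kingTwoSpacingFull L a msq j n).lo.S := inferInstanceAs (DecidableEq (Tor (fine (L ^ j.K) (kingVol L j))))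
  letI : Fintype (kingTwoSpacingFull L a msq j n).hi.S := inferInstanceAs (Fintype (Tor (fine (L ^ (j.K + n)) (kingVol L j))))
  have hCe : C ≤ C * Real.exp δ₀ := le_mul_of_one_le_right hC.le (Real.one_le_exp hδ₀.le)
  have h37e : Prop37PrintedAt α (kingTwoSpacingFull L a msq j n).lo (C * Real.exp δ₀) δ₀ :=
    prop37PrintedAt_mono (D := (kingTwoSpacingFull L a msq j n).lo) hL1 (kingTwoSpacingFull_lodist_nonneg L a msq j n) (fun _ _ b => nomatch b) hC.le hCe le_rfl h37
  have h39e : Prop39PrintedAt α (kingTwoSpacingFull L a msq j n) (C * Real.exp δ₀) δ₀ γ :=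
    prop39PrintedAt_mono (T := kingTwoSpacingFull L a msq j n) hL1 (kingTwoSpacingFull_lodist_nonneg L a msq j n) (fun _ _ b => nomatch b) hC.le hCe le_rfl le_rfl h39
  have hhi : ∀ jl : ℕ, jl + 1 ≤ (kingTwoSpacingFull L a msq j n).lo.k → ∀ (κ : Option (Fin (d + 1))) (x' y' : (kingTwoSpacingFull L a msq j n).hi.S),
      ‖hiLine (kingTwoSpacingFull L a msq j n) jl κ x' y'‖ ≤ sizeProfile (kingTwoSpacingFull L a msq j n) (C * Real.exp δ₀) δ₀ jl κ ((kingTwoSpacingFull L a msq j n).pt x') ((kingTwoSpacingFull L a msq j n).pt y') :=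
    fun jl hjl κ x' y' => hiLine_kingTwoSpacingFull_le L hL a msq j n hC.le hδ₀.le h37' hjl κ x' y'
  have hfib : ∀ x : (kingTwoSpacingFull L a msq j n).lo.S, (univ.filter fun x' : (kingTwoSpacingFull L a msq j n).hi.S => (kingTwoSpacingFull L a msq j n).pt x' = x).card = (L ^ n) ^ (d + 1) :=
    fun x => card_filter_kingSlicePt L j.K n (kingVol L j) x
  have hw := king_weight_repair (d := d) L hL0 j.K n
  have h := graph_replacement_twoSpacing_reduced (kingTwoSpacingFull L a msq j n) h37e hhi h39e hfib hw src tgt js hjs κ vtx u u' p q hp hp' hq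
  have hnorm : ‖(((L : ℝ) ^ j.K)⁻¹) ^ (d + 1)‖ = (((L : ℝ) ^ j.K)⁻¹) ^ (d + 1) := Real.norm_of_nonneg (by positivity)
  rw [hnorm] at h
  exact h

/-- ★★★ **THE RATIO FORM BY NAME AT `A = 0`**: with the same `(C, δ₀, γ)`, for one-vertex rates proportional to their sizes (`q_υ = ϑ_υ·p_υ`),
`|E^{(K+n)}(H(j)) − E^{(K)}(H(j))| ≤ (Σ_ℓ L^{−γ j_ℓ} + Σ_υ ϑ_υ)·𝔼^{(K)}_{C,δ₀}(H(j))` — THE η-RATE OF A SLICE-ASSIGNED GRAPH OF KING's `A = 0` MODEL IS `Σ_ℓ L^{−γ j_ℓ}`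
TIMES ITS (3.63)-SIZE (part Η-b `graph_replacement_twoSpacing_ratio`).  Honest: no gain on lines at the finest slices; the positive degrees supply it in print.
[cite: King1986, pp.664–665 (proof of Prop. 3.6), (3.63) p.663, (3.73) p.665] -/
theorem king_graph_replacement_zeroField_ratio (hLodd : Odd L) (hL : 2 ≤ L) {a : ℝ} (ha : 0 < a) {m0sq : ℝ} (hm0 : 0 ≤ m0sq)
    {α : ℝ} (hα0 : 0 < α) (hα1 : α < 1) :
    ∃ C δ₀ γ : ℝ, 0 < C ∧ 0 < δ₀ ∧ 0 < γ ∧ ∀ (msq : ℝ), 0 < msq → msq ≤ m0sq → ∀ (j : KingVolIndex d) (n : ℕ), 1 ≤ n →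
      ∀ (V Λ Υ : Type) [Fintype V] [DecidableEq V] [Fintype Λ] [DecidableEq Λ] [Fintype Υ] [DecidableEq Υ]
        (src tgt : Λ → V) (js : Λ → ℕ), (∀ ℓ, js ℓ + 1 ≤ j.K) → ∀ (κ : Λ → Option (Fin (d + 1))) (vtx : Υ → V),
        haveI := kingVol_neZero L j
        ∀ (u : Υ → Tor (fine (L ^ j.K) (kingVol L j)) → ℝ) (u' : Υ → Tor (fine (L ^ (j.K + n)) (kingVol L j)) → ℝ)
          (p : Υ → Tor (fine (L ^ j.K) (kingVol L j)) → ℝ) (ϑ : Υ → ℝ),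
          (∀ υ x, ‖u υ x‖ ≤ p υ x) → (∀ υ x', ‖u' υ x'‖ ≤ p υ (kingSlicePt L j.K n (kingVol L j) x')) →
          (∀ υ x', ‖u' υ x' - u υ (kingSlicePt L j.K n (kingVol L j) x')‖ ≤ ϑ υ * p υ (kingSlicePt L j.K n (kingVol L j) x')) →
          ‖graphValLS ((((L : ℝ) ^ (j.K + n))⁻¹) ^ (d + 1)) src tgt (fun ℓ => kingHiLine L a msq j n (js ℓ) (κ ℓ)) vtx u'
              - graphValLS ((((L : ℝ) ^ j.K)⁻¹) ^ (d + 1)) src tgt (fun ℓ => kingLoLine L a msq j n (js ℓ) (κ ℓ)) vtx u‖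
            ≤ (∑ ℓ, (L : ℝ) ^ (-(γ * js ℓ)) + ∑ υ, ϑ υ)
                * graphValLS ((((L : ℝ) ^ j.K)⁻¹) ^ (d + 1)) src tgt (fun ℓ => kingSizeProfile L a msq j n C δ₀ (js ℓ) (κ ℓ)) vtx p := by
  obtain ⟨C, δ₀, γ, hC, hδ₀, hγ, H⟩ := king_props37_38_39_commonConstants (d := d) L hLodd hL ha hm0 hα0 hα1
  have hL1 : 1 ≤ L := by omega
  have hL0 : (0 : ℝ) < L := by exact_mod_cast (show 0 < L by omega)
  refine ⟨C * Real.exp δ₀, δ₀, γ, by positivity, hδ₀, hγ, fun msq hm hcap j n hn V Λ Υ _ _ _ _ _ _ src tgt js hjs κ vtx u u' p ϑ hp hp' hq => ?_⟩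
  haveI := kingVol_neZero L j
  obtain ⟨h37, h37', -, h39⟩ := H msq hm hcap j n hn
  letI : Fintype (kingTwoSpacingFull L a msq j n).lo.S := inferInstanceAs (Fintype (Tor (fine (L ^ j.K) (kingVol L j))))
  letI : DecidableEq (kingTwoSpacingFull L a msq j n).lo.S := inferInstanceAs (DecidableEq (Tor (fine (L ^ j.K) (kingVol L j))))
  letI : Fintype (kingTwoSpacingFull L a msq j n).hi.S := inferInstanceAs (Fintype (Tor (fine (L ^ (j.K + n)) (kingVol L j))))
  have hCe : C ≤ C * Real.exp δ₀ := le_mul_of_one_le_right hC.le (Real.one_le_exp hδ₀.le)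
  have h37e : Prop37PrintedAt α (kingTwoSpacingFull L a msq j n).lo (C * Real.exp δ₀) δ₀ :=
    prop37PrintedAt_mono (D := (kingTwoSpacingFull L a msq j n).lo) hL1 (kingTwoSpacingFull_lodist_nonneg L a msq j n) (fun _ _ b => nomatch b) hC.le hCe le_rfl h37
  have h39e : Prop39PrintedAt α (kingTwoSpacingFull L a msq j n) (C * Real.exp δ₀) δ₀ γ :=
    prop39PrintedAt_mono (T := kingTwoSpacingFull L a msq j n) hL1 (kingTwoSpacingFull_lodist_nonneg L a msq j n) (fun _ _ b => nomatch b) hC.le hCe le_rfl le_rfl h39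
  have hhi : ∀ jl : ℕ, jl + 1 ≤ (kingTwoSpacingFull L a msq j n).lo.k → ∀ (κ : Option (Fin (d + 1))) (x' y' : (kingTwoSpacingFull L a msq j n).hi.S),
      ‖hiLine (kingTwoSpacingFull L a msq j n) jl κ x' y'‖ ≤ sizeProfile (kingTwoSpacingFull L a msq j n) (C * Real.exp δ₀) δ₀ jl κ ((kingTwoSpacingFull L a msq j n).pt x') ((kingTwoSpacingFull L a msq j n).pt y') :=
    fun jl hjl κ x' y' => hiLine_kingTwoSpacingFull_le L hL a msq j n hC.le hδ₀.le h37' hjl κ x' y'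
  have hfib : ∀ x : (kingTwoSpacingFull L a msq j n).lo.S, (univ.filter fun x' : (kingTwoSpacingFull L a msq j n).hi.S => (kingTwoSpacingFull L a msq j n).pt x' = x).card = (L ^ n) ^ (d + 1) :=
    fun x => card_filter_kingSlicePt L j.K n (kingVol L j) x
  have hw := king_weight_repair (d := d) L hL0 j.K n
  have hTL : 0 < (kingTwoSpacingFull L a msq j n).lo.L := by show 0 < L; omega
  have h := graph_replacement_twoSpacing_ratio (kingTwoSpacingFull L a msq j n) hTL h37e hhi h39e hfib hw src tgt js hjs κ vtx u u' p ϑ hp hp' hq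
  have hnorm : ‖(((L : ℝ) ^ j.K)⁻¹) ^ (d + 1)‖ = (((L : ℝ) ^ j.K)⁻¹) ^ (d + 1) := Real.norm_of_nonneg (by positivity)
  rw [hnorm] at h
  exact h

/-- ★ **THE SIZE HALF BY NAME AT `A = 0`**: with the same `(C, δ₀)`, both graph values are bounded by the majorant graph `𝔼^{(K)}_{C,δ₀}(H(j))` of the (3.63)-profiles
(the fine one through the re-pairing) — p. 664 *«replacing every propagator by the bounds given in Proposition 3.7»* (part Η-b `graph_size_twoSpacing`).
[cite: King1986, p.664 (proof of Prop. 3.6), Prop. 3.7 (3.63) p.663] -/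
theorem king_graph_size_zeroField (hLodd : Odd L) (hL : 2 ≤ L) {a : ℝ} (ha : 0 < a) {m0sq : ℝ} (hm0 : 0 ≤ m0sq)
    {α : ℝ} (hα0 : 0 < α) (hα1 : α < 1) :
    ∃ C δ₀ : ℝ, 0 < C ∧ 0 < δ₀ ∧ ∀ (msq : ℝ), 0 < msq → msq ≤ m0sq → ∀ (j : KingVolIndex d) (n : ℕ), 1 ≤ n →
      ∀ (V Λ Υ : Type) [Fintype V] [DecidableEq V] [Fintype Λ] [DecidableEq Λ] [Fintype Υ] [DecidableEq Υ]
        (src tgt : Λ → V) (js : Λ → ℕ), (∀ ℓ, js ℓ + 1 ≤ j.K) → ∀ (κ : Λ → Option (Fin (d + 1))) (vtx : Υ → V),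
        haveI := kingVol_neZero L j
        ∀ (u : Υ → Tor (fine (L ^ j.K) (kingVol L j)) → ℝ) (u' : Υ → Tor (fine (L ^ (j.K + n)) (kingVol L j)) → ℝ)
          (p : Υ → Tor (fine (L ^ j.K) (kingVol L j)) → ℝ),
          (∀ υ x, ‖u υ x‖ ≤ p υ x) → (∀ υ x', ‖u' υ x'‖ ≤ p υ (kingSlicePt L j.K n (kingVol L j) x')) →
          ‖graphValLS ((((L : ℝ) ^ j.K)⁻¹) ^ (d + 1)) src tgt (fun ℓ => kingLoLine L a msq j n (js ℓ) (κ ℓ)) vtx u‖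
              ≤ graphValLS ((((L : ℝ) ^ j.K)⁻¹) ^ (d + 1)) src tgt (fun ℓ => kingSizeProfile L a msq j n C δ₀ (js ℓ) (κ ℓ)) vtx p ∧
          ‖graphValLS ((((L : ℝ) ^ (j.K + n))⁻¹) ^ (d + 1)) src tgt (fun ℓ => kingHiLine L a msq j n (js ℓ) (κ ℓ)) vtx u'‖
              ≤ graphValLS ((((L : ℝ) ^ j.K)⁻¹) ^ (d + 1)) src tgt (fun ℓ => kingSizeProfile L a msq j n C δ₀ (js ℓ) (κ ℓ)) vtx p := by
  obtain ⟨C, δ₀, γ, hC, hδ₀, -, H⟩ := king_props37_38_39_commonConstants (d := d) L hLodd hL ha hm0 hα0 hα1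
  have hL1 : 1 ≤ L := by omega
  have hL0 : (0 : ℝ) < L := by exact_mod_cast (show 0 < L by omega)
  refine ⟨C * Real.exp δ₀, δ₀, by positivity, hδ₀, fun msq hm hcap j n hn V Λ Υ _ _ _ _ _ _ src tgt js hjs κ vtx u u' p hp hp' => ?_⟩
  haveI := kingVol_neZero L j
  obtain ⟨h37, h37', -, -⟩ := H msq hm hcap j n hn
  letI : Fintype (kingTwoSpacingFull L a msq j n).lo.S := inferInstanceAs (Fintype (Tor (fine (L ^ j.K) (kingVol L j))))
  letI : DecidableEq (kingTwoSpacingFull L a msq j n).lo.S := inferInstanceAs (DecidableEq (Tor (fine (L ^ j.K) (kingVol L j))))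
  letI : Fintype (kingTwoSpacingFull L a msq j n).hi.S := inferInstanceAs (Fintype (Tor (fine (L ^ (j.K + n)) (kingVol L j))))
  have hCe : C ≤ C * Real.exp δ₀ := le_mul_of_one_le_right hC.le (Real.one_le_exp hδ₀.le)
  have h37e : Prop37PrintedAt α (kingTwoSpacingFull L a msq j n).lo (C * Real.exp δ₀) δ₀ :=
    prop37PrintedAt_mono (D := (kingTwoSpacingFull L a msq j n).lo) hL1 (kingTwoSpacingFull_lodist_nonneg L a msq j n)
      (fun _ _ b => nomatch b) hC.le hCe le_rfl h37
  have hhi : ∀ jl : ℕ, jl + 1 ≤ (kingTwoSpacingFull L a msq j n).lo.k →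
      ∀ (κ : Option (Fin (d + 1))) (x' y' : (kingTwoSpacingFull L a msq j n).hi.S),
      ‖hiLine (kingTwoSpacingFull L a msq j n) jl κ x' y'‖
        ≤ sizeProfile (kingTwoSpacingFull L a msq j n) (C * Real.exp δ₀) δ₀ jl κ
          ((kingTwoSpacingFull L a msq j n).pt x') ((kingTwoSpacingFull L a msq j n).pt y') :=
    fun jl hjl κ x' y' => hiLine_kingTwoSpacingFull_le L hL a msq j n hC.le hδ₀.le h37' hjl κ x' y'
  have hfib : ∀ x : (kingTwoSpacingFull L a msq j n).lo.S,
      (univ.filter fun x' : (kingTwoSpacingFull L a msq j n).hi.S => (kingTwoSpacingFull L a msq j n).pt x' = x).card = (L ^ n) ^ (d + 1) :=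
    fun x => card_filter_kingSlicePt L j.K n (kingVol L j) x
  have hw := king_weight_repair (d := d) L hL0 j.K n
  have h := graph_size_twoSpacing (kingTwoSpacingFull L a msq j n) h37e hhi hfib hw src tgt js hjs κ vtx u u' p hp hp'
  have hnorm : ‖(((L : ℝ) ^ j.K)⁻¹) ^ (d + 1)‖ = (((L : ℝ) ^ j.K)⁻¹) ^ (d + 1) := Real.norm_of_nonneg (by positivity)
  rw [hnorm] at h
  exact h

end ByName

end Summit.QuantumFields.YangMills.BalabanUVNodes.N15KingModelRung.Curved

end
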